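import Literature.Claims.NS.ClayR3LerayHopfBridge
import HarnessLib

/-!
# CLAIM C163 — W. Seo, «On the Structural Stability of Fluid Dynamics: A Proof of the Navier-Stokes
# Existence and Smoothness via Seo's Entropy Barrier» («Seo Series V», Zenodo 17921206, 2025-12-13, 4 pp.)

Cell `ns-claims` (D-0090), claim **C163**, typist of record `ns-claims-typist-5 g6` (RULINGS v1.40 (1)).
TEXT OF RECORD: Zenodo record 17921206 (concept 17921205, single version), PDF sha256[:16]
`4626f623fe941c74`, 4 pp., PDF page = printed page; pin `census/texts/Seo2025/`. NOTHING of the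
paper is asserted: the claimed statements and the printed steps are `def … : Prop` (steps indexed by
the viscosity `ν` and, where the print uses it, by the unspecified constant `C_Sobolev`); the theorems of
§D are pure logic plus tree bridges.

## What is printed (the whole text is 4 pages)

* Abstract p.1 l.8–14: «This paper resolves the Millennium Prize problem … we prove that finite-time
  blow-up is topologically impossible … the stability gap remains strictly positive for all t ≥ 0»,
  display (1) «∀t ≥ 0, ‖u(·,t)‖_{H¹} < ∞ due to D_NS(t) > 0». (2) p.1 l.18–19: the momentum
  equation only (no divergence constraint, no domain, no data class printed there). (3) p.1 l.23–25
  «lim sup_{t→T*} ‖u(t)‖_{L∞} ≤ B_Seo < ∞». Def 2.1 / (4) p.1 l.31–38: the «Seo Entropy Barrier»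
  and «ν_eff(u) = ν₀ · exp(‖u‖²/B_Seo)» (a solution-dependent viscosity — not the equation of Clay
  (A); recorded, not typed).
* Thm 3.1 p.2 l.5–24: «E(t) = ½‖u(t)‖²_{L²} … (5) dE/dt ≤ −ν‖∇u‖²_{L²} + C‖u‖³_{L³}», «(6)
  ν‖∇u‖²_{L²} ≫ C‖u‖³_{L³} as ‖u‖ → B_Seo»; Figure 1 p.2 l.25–29 «the actual energy trajectory … is
  topologically unable to cross the Seo Barrier». NOT used by the printed proof of Thm 4.1 (chair);
  its energy-boundedness content is typed as `Thm31_energyBarrier` because the Clay reading needs it.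
* Def 4.1 p.3 l.3–22: (7) «D_NS(t) := d/dt(Dissipation) − |d/dt(Accumulation)|», (8)
  «D_NS(t) = ν‖∇u‖²_{H¹} − C_Sobolev‖u·∇u‖_{L²}» — typed with a body (`Dns`).
* **Thm 4.1 (9) p.3 l.23–29**: «For all initial data u₀ ∈ L²(ℝ³), the Seo Discriminant is strictly
  positive for all t > 0. D_NS(t) ≥ K_Seo > 0». Proof p.3 l.33 – p.4 l.2: «By the Principle of
  Barrier Universality (Paper IV), the "Velocity Gap" between the barrier and the system state is
  invariant. Since D_NS(t) > 0 (as shown in Figure 2), there is no time t such that the accumulation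
  rate exceeds the dissipation capacity. Thus, the solution remains smooth (C∞) for all time.»
  (10) p.4 l.3–4: «u(x,t) ∈ C^∞(ℝ³ × [0,∞))». §5 p.4 l.8–9: «Existence: Guaranteed by the Seo
  Entropy Barrier [Equation (4)]. Smoothness: Guaranteed by the positivity of D_NS(t) [Equation (9)].»

## How it is typed

* `Dns ν Cs v = ν·‖∇v‖²_{H¹} − Cs·‖(v·∇)v‖_{L²}` on a single field `v = u(·,t)` ((8); the norms as
  extended-real Lebesgue integrals turned real — honest where they are finite, junk `0` on fields with
  infinite `H²`/advection norms; recorded). `K_Seo` is printed as ONE universal constant («a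
  universal constant», abstract l.10) — typed `∃ K > 0` BEFORE the data.
* `Thm41 ν Cs` = (9) AT THE PRINTED GRAIN: every `L²` weakly divergence-free datum, every classical
  solution on a slab `[0,T) × ℝ³` issuing from it, every `t ∈ (0,T)`. The printed class contains the
  rest state (`u₀ = 0`, `u ≡ 0`, where `Dns = 0`); the chair's pre-registered charitable faces are typed
  separately: `Thm41_nz` (rest state excluded) and `Thm41_clay` (the Millennium problem's intended
  class: nonzero data of Fefferman's class (4), the paper's own global smooth solutions (10)); both
  are IMPLIED by `Thm41` (`thm41_nz_of`, `thm41_clay_of`). Typist's flag (no verdict): both terms of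
  (8) are homogeneous of degree 2 in the amplitude (`Dns ν Cs (c • v) = c² · Dns ν Cs v` where the
  norms are finite), and under the Navier–Stokes scaling `u_λ(x,t) = λu(λx, λ²t)` they scale like
  `λ`, `λ³` and `λ^{3/2}` respectively — no datum-uniform `K_Seo > 0` is compatible with either.
* The printed PROOF of (9) is a citation (Paper IV) plus a figure: its two ingredients are typed as
  named posits at the grain the proof uses them — `PaperIV_GapInvariant` («the Velocity Gap … is
  invariant»: `Dns` constant in time along every solution) and `Fig2_Positive` («D_NS(t) > 0 as shown
  in Figure 2») — and `Proof41_Composes` RECORDS the shape «invariance + positivity ⇒ (9)» as a `Prop`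
  (not a theorem: pointwise positivity and invariance give a constant PER SOLUTION, not the printed
  datum-uniform `K_Seo` — LOGIC note). Posits are not steps (RULINGS 11:21Z (1)).
* `Step_9to10 ν Cs` = the printed inference (9) ⇒ (10) (p.3 l.34 – p.4 l.4); `claim_of_steps`
  composes `Thm41` and `Step_9to10` into `ClaimedTheorem` (every typed step consumed).
* `ClaimedTheorem` = (10) for «all initial data u₀ ∈ L²(ℝ³)» AS PRINTED (smoothness on the CLOSED
  half-space from `t = 0`; typist's flag: for a non-smooth `L²` datum (10) fails at `t = 0` since
  `u(0) = u₀` — the statement over-claims; the Clay reading restricts to class-(4) data).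
  `clay_of_claimed : ClaimedTheorem → (∀ ν, Thm31_energyBarrier ν) → clayR3.Regularity` — (A) needs
  the bounded-energy clause (7), which the text asserts only through Thm 3.1 / Figure 1.

WHAT THIS IS NOT: not a claim about NS regularity or blow-up; not a claim about any author beyond the
typed locator.
-/

open scoped ContDiff ENNReal NNReal Topology
open _root_.MeasureTheory _root_.Set Function

noncomputable section

namespace Literature.Claims.NS.Seo2025

open Literature.Analysis.FluidPDE Literature.Claims.NS.ClayVariants

/-! ## A. Vocabulary -/

/-- Euclidean `ℝ³`. [folklore] -/
abbrev E3 : Type := EuclideanSpace ℝ (Fin 3)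

/-- `‖∇v‖²_{H¹} = ‖∇v‖²_{L²} + ‖∇²v‖²_{L²}` (extended real; operator norms of the first and second
Fréchet derivatives). [cite: Seo2025, (8) p.3] -/
def gradH1Sq (v : E3 → E3) : ℝ≥0∞ :=
  (∫⁻ x, ‖fderiv ℝ v x‖ₑ ^ 2) + ∫⁻ x, ‖iteratedFDeriv ℝ 2 v x‖ₑ ^ 2

/-- `‖(v·∇)v‖_{L²}` (extended real; `(v·∇)v (x) = Dv(x)[v(x)]`). [cite: Seo2025, (8) p.3] -/
def advL2 (v : E3 → E3) : ℝ≥0∞ := (∫⁻ x, ‖fderiv ℝ v x (v x)‖ₑ ^ 2) ^ (1 / 2 : ℝ)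

/-- **Def 4.1 (8) p.3 l.19–22, the Seo Discriminant of a state `v = u(·,t)`**:
`D_NS = ν‖∇v‖²_{H¹} − C_Sobolev‖v·∇v‖_{L²}` (real; the two norms made real by `toReal`, so junk `0`
on a field with an infinite norm — honest on fields with finite `H²` and advection norms, e.g. all of
Fefferman's class (4) and the rest state). [cite: Seo2025, Def 4.1 (7)–(8) p.3] -/
def Dns (ν Cs : ℝ) (v : E3 → E3) : ℝ := ν * (gradH1Sq v).toReal - Cs * (advL2 v).toReal

/-! ## B. The claimed statement (nothing asserted) -/

/-- **(10) p.4 l.1–4 with Thm 4.1's data class p.3 l.23–27, at viscosity `ν`**: for every datum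
`u₀ ∈ L²(ℝ³)` (weakly divergence-free) there are `u, p` smooth on `ℝ³ × [0,∞)` solving the unforced
Navier–Stokes system with `u(0) = u₀` («u(x,t) ∈ C^∞(ℝ³ × [0,∞))»). AS PRINTED — for a non-smooth
`L²` datum this fails at `t = 0` (`u(0) = u₀`); recorded, not repaired.
[claim: Seo2025, status: disputed] [cite: Seo2025, (10) p.4 l.1–4; Thm 4.1 p.3 l.23–27] -/
def ClaimedAt (ν : ℝ) : Prop :=
  ∀ u₀ : E3 → E3, MemLp u₀ 2 volume → IsWeaklyDivFree u₀ →
    ∃ (u : ℝ → E3 → E3) (p : ℝ → E3 → ℝ),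
      IsSmoothOnHalfSpace u ∧ IsSmoothOnHalfSpace p ∧ IsNavierStokesSolution ν 0 u₀ u p

/-- **CLAIMED THEOREM** (abstract p.1 l.9–13 «resolves the Millennium Prize problem … global existence
and smoothness of solutions»; (10) p.4; §5 p.4 l.8–9), every `ν > 0`.
[claim: Seo2025, status: disputed] [cite: Seo2025, abstract p.1; (10) p.4; §5 p.4] -/
def ClaimedTheorem : Prop := ∀ ν : ℝ, 0 < ν → ClaimedAt ν

/-! ## C. The printed steps and posits (nothing asserted) -/

/-- **Thm 4.1 (9) p.3 l.23–29, AS PRINTED** («For all initial data `u₀ ∈ L²(ℝ³)`, the Seo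
Discriminant is strictly positive for all `t > 0`. `D_NS(t) ≥ K_Seo > 0`»; `K_Seo` «a universal
constant», abstract l.10): there is `K > 0` such that for every `L²` weakly divergence-free datum,
every classical solution `(u, p)` on a slab `[0, T) × ℝ³` with `u(0) = u₀` and every `t ∈ (0, T)`,
`K ≤ D_NS(u(t))`. The printed class contains the rest state. [claim: Seo2025, status: disputed]
[cite: Seo2025, Thm 4.1 (9) p.3 l.23–29] -/
def Thm41 (ν Cs : ℝ) : Prop :=
  0 < ν → ∃ K : ℝ, 0 < K ∧
    ∀ u₀ : E3 → E3, MemLp u₀ 2 volume → IsWeaklyDivFree u₀ →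
      ∀ (T : ℝ) (u : ℝ → E3 → E3) (p : ℝ → E3 → ℝ),
        IsClassicalNSSolutionOn (Ico 0 T) ν 0 u p → u 0 = u₀ →
          ∀ t ∈ Ioo 0 T, K ≤ Dns ν Cs (u t)

/-- **(9), charitable face 1 — the rest state excluded** (datum not a.e. zero; the chair's
pre-registered re-typing, RULINGS v1.40 (1)). Implied by `Thm41` (`thm41_nz_of`).
[claim: Seo2025, status: disputed] [cite: Seo2025, Thm 4.1 (9) p.3 l.23–29] -/
def Thm41_nz (ν Cs : ℝ) : Prop :=
  0 < ν → ∃ K : ℝ, 0 < K ∧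
    ∀ u₀ : E3 → E3, MemLp u₀ 2 volume → IsWeaklyDivFree u₀ → ¬ (u₀ =ᵐ[volume] 0) →
      ∀ (T : ℝ) (u : ℝ → E3 → E3) (p : ℝ → E3 → ℝ),
        IsClassicalNSSolutionOn (Ico 0 T) ν 0 u p → u 0 = u₀ →
          ∀ t ∈ Ioo 0 T, K ≤ Dns ν Cs (u t)

/-- **(9), charitable face 2 — the Millennium problem's intended class**: nonzero data of Fefferman's
class (4) (smooth, divergence-free, rapidly decaying) and the paper's own global smooth solutions (10)
on `ℝ³ × [0, ∞)`; `t > 0`. Implied by `Thm41` (`thm41_clay_of`).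
[claim: Seo2025, status: disputed] [cite: Seo2025, Thm 4.1 (9) p.3 l.23–29; (10) p.4] -/
def Thm41_clay (ν Cs : ℝ) : Prop :=
  0 < ν → ∃ K : ℝ, 0 < K ∧
    ∀ u₀ : E3 → E3, ContDiff ℝ ∞ u₀ → NSWave0.IsDivFree u₀ → HasRapidSpatialDecay u₀ → u₀ ≠ 0 →
      ∀ (u : ℝ → E3 → E3) (p : ℝ → E3 → ℝ),
        IsSmoothOnHalfSpace u → IsSmoothOnHalfSpace p → IsNavierStokesSolution ν 0 u₀ u p →
          ∀ t : ℝ, 0 < t → K ≤ Dns ν Cs (u t)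

/-- **Posit of the printed proof, p.3 l.33–34** («By the Principle of Barrier Universality (Paper IV),
the "Velocity Gap" between the barrier and the system state is invariant»), at the grain the proof
uses it: `D_NS` is constant in time along every classical solution. A cited principle of the
author's Paper IV — a NAMED BINDER, not a step of this text. [claim: Seo2025, status: disputed]
[cite: Seo2025, proof of Thm 4.1 p.3 l.33–34] -/
def PaperIV_GapInvariant (ν Cs : ℝ) : Prop :=
  ∀ (T : ℝ) (u : ℝ → E3 → E3) (p : ℝ → E3 → ℝ), IsClassicalNSSolutionOn (Ico 0 T) ν 0 u p →
    ∀ s ∈ Ico 0 T, ∀ t ∈ Ico 0 T, Dns ν Cs (u s) = Dns ν Cs (u t)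

/-- **Posit of the printed proof, p.3 l.34** («Since `D_NS(t) > 0` (as shown in Figure 2)»): pointwise
positivity along every classical solution — read off a schematic figure; a NAMED BINDER, not a step.
[claim: Seo2025, status: disputed] [cite: Seo2025, proof of Thm 4.1 p.3 l.34; Figure 2 p.3 l.30–32] -/
def Fig2_Positive (ν Cs : ℝ) : Prop :=
  ∀ (T : ℝ) (u : ℝ → E3 → E3) (p : ℝ → E3 → ℝ), IsClassicalNSSolutionOn (Ico 0 T) ν 0 u p →
    ∀ t ∈ Ioo 0 T, 0 < Dns ν Cs (u t)

/-- **The SHAPE of the printed proof of (9)** — «gap invariant» + «positive (Figure 2)» ⇒ (9) — recorded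
as a `Prop`, NOT proved: invariance and pointwise positivity yield a positive constant PER SOLUTION,
not the datum-uniform `K_Seo` of (9). `-- LOGIC: the uniformity in the datum is nowhere argued.`
[claim: Seo2025, status: disputed] [cite: Seo2025, proof of Thm 4.1 p.3 l.33 – p.4 l.2] -/
def Proof41_Composes (ν Cs : ℝ) : Prop :=
  PaperIV_GapInvariant ν Cs → Fig2_Positive ν Cs → Thm41 ν Cs

/-- **The printed inference (9) ⇒ (10), p.3 l.34 – p.4 l.4** («Since `D_NS(t) > 0` … there is no time
`t` such that the accumulation rate exceeds the dissipation capacity. Thus, the solution remains smooth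
(C∞) for all time. `u(x,t) ∈ C^∞(ℝ³ × [0,∞))`»). [claim: Seo2025, status: disputed]
[cite: Seo2025, p.3 l.34 – p.4 l.4] -/
def Step_9to10 (ν Cs : ℝ) : Prop := Thm41 ν Cs → ClaimedAt ν

/-- **Thm 3.1 p.2 l.3–11 with Figure 1 p.2 l.25–29** («the energy curve is structurally forced to bend
downwards before reaching infinity»; «the actual energy trajectory … is topologically unable to cross
the Seo Barrier»), at the grain the Clay reading needs: every global smooth solution of (10) from an
`L²` datum has bounded energy. Not used by the printed proof of Thm 4.1; consumed by
`clay_of_claimed` only. [claim: Seo2025, status: disputed]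
[cite: Seo2025, Thm 3.1 p.2 l.3–11; Figure 1 p.2 l.25–29; Def 2.1 p.1 l.31–33] -/
def Thm31_energyBarrier (ν : ℝ) : Prop :=
  ∀ u₀ : E3 → E3, MemLp u₀ 2 volume → IsWeaklyDivFree u₀ →
    ∀ (u : ℝ → E3 → E3) (p : ℝ → E3 → ℝ),
      IsSmoothOnHalfSpace u → IsSmoothOnHalfSpace p → IsNavierStokesSolution ν 0 u₀ u p →
        HasBoundedEnergy u

/-! ## D. Kernel-checked relations (pure logic + tree bridges; nothing of the paper is asserted) -/

/-- **COMPOSITION** — every typed step consumed: (9) and the inference (9) ⇒ (10) give the claimed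
theorem (for any value of the unspecified `C_Sobolev`). [cite: Seo2025, §5 p.4 l.8–9] -/
theorem claim_of_steps (Cs : ℝ) (h41 : ∀ ν, Thm41 ν Cs) (h910 : ∀ ν, Step_9to10 ν Cs) :
    ClaimedTheorem :=
  fun ν _hν => h910 ν (h41 ν)

/-- The printed face implies the rest-state-excluded face (pure logic). [cite: Seo2025, Thm 4.1 p.3] -/
theorem thm41_nz_of {ν Cs : ℝ} (h : Thm41 ν Cs) : Thm41_nz ν Cs := by
  intro hν
  obtain ⟨K, hK, hall⟩ := h hν
  exact ⟨K, hK, fun u₀ h2 hdiv _hnz T u p hcl h0 t ht => hall u₀ h2 hdiv T u p hcl h0 t ht⟩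

/-- A Clay datum (smooth, divergence-free, rapidly decaying) is an `L²` weakly divergence-free datum
(tree lemmas). [cite: FeffermanClay2006, (4) p.1] -/
theorem memLp_and_weaklyDivFree_of_clayDatum {u₀ : E3 → E3} (hsm : ContDiff ℝ ∞ u₀)
    (hdiv : NSWave0.IsDivFree u₀) (hdec : HasRapidSpatialDecay u₀) :
    MemLp u₀ 2 volume ∧ IsWeaklyDivFree u₀ := by
  have hfin : ∫⁻ y, ‖u₀ y‖ₑ ^ 2 < ⊤ := by
    refine lt_of_le_of_lt (le_of_eq (lintegral_congr fun y => ?_))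
      (hdec.lintegral_enorm_iteratedFDeriv_sq_lt_top (μ := volume) 0)
    rw [← ofReal_norm, ← ofReal_norm, norm_iteratedFDeriv_zero]
  exact ⟨⟨hsm.continuous.aestronglyMeasurable, eLpNorm_two_lt_top_of_lintegral_enorm_sq_lt_top hfin⟩,
    VectorCalculus.IsDivFree.isWeaklyDivFree_holds (fun y => hdiv y) (hsm.of_le (mod_cast le_top))⟩

/-- The printed face implies the intended-class face: a global smooth solution of (10) is a classical
solution on every slab `[0, T)` (tree: `isNavierStokesSolution_and_smooth_iff`).
[cite: Seo2025, Thm 4.1 p.3; (10) p.4] -/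
theorem thm41_clay_of {ν Cs : ℝ} (h : Thm41 ν Cs) : Thm41_clay ν Cs := by
  intro hν
  obtain ⟨K, hK, hall⟩ := h hν
  refine ⟨K, hK, fun u₀ hsm hdiv hdec _hnz u p hsu hsp hns t ht => ?_⟩
  obtain ⟨h2, hwd⟩ := memLp_and_weaklyDivFree_of_clayDatum hsm hdiv hdec
  have hcl : IsClassicalNSSolutionOn (Ici 0) ν 0 u p :=
    (isNavierStokesSolution_and_smooth_iff.1 ⟨hns, hsu, hsp⟩).1
  have hslab : IsClassicalNSSolutionOn (Ico 0 (t + 1)) ν 0 u p :=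
    hcl.mono Ico_subset_Ici_self (uniqueDiffOn_Ico 0 (t + 1))
  exact hall u₀ h2 hwd (t + 1) u p hslab hns.initial t ⟨ht, by linarith⟩

/-- **CLAY READING — PROVED modulo the paper's own energy claim**: the claimed theorem together with
Thm 3.1's energy barrier gives Fefferman's (A) (class-(4) data are `L²` and weakly divergence-free;
(A) asks for smooth `(p, u)` solving (1)–(3) with bounded energy (7)).
[cite: Seo2025, (10) p.4; Thm 3.1 p.2] [cite: FeffermanClay2006, (A) with (4) (6) (7) p.2] -/
theorem clay_of_claimed (h : ClaimedTheorem) (hE : ∀ ν, Thm31_energyBarrier ν) :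
    clayR3.Regularity := by
  intro ν hν u₀ hsm hdiv hdec
  obtain ⟨h2, hwd⟩ := memLp_and_weaklyDivFree_of_clayDatum hsm hdiv hdec
  obtain ⟨u, p, hsu, hsp, hns⟩ := h ν hν u₀ h2 hwd
  exact ⟨u, p, hsu, hsp, hns, hE ν u₀ h2 hwd u p hsu hsp hns⟩

end Literature.Claims.NS.Seo2025

end

-- WHAT THIS IS NOT: not a claim about NS regularity or blow-up; not a claim about any author beyond the typed locator.
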